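import Mathlib
import Summits.ValiantsHypothesis.ValiantsHypothesis.Theorems.GrenetZeonTwoDimCoefficientsSqrtTwoRung
import Literature.Computability.AlgebraicComplexity.AlgDetRepr
import HarnessLib

/-!
# Crux `GrenetZeon.PolySizeQPAlgebra` (stmt-ValiantsHypothesis-8064), `c = 1` box — the whole
# `s ≤ 2` SLICE is empty (bookkeeping over the 8062 development)

Census correction for the piece `PolySizeQPAlgebra` at `c = 1` (box `m ≤ n + 1`, `s ≤ 2·2^(log₂ n)`; by the
degree floor only `m ∈ {n, n+1}` occurs).  The `√2·n` rung of the sibling crux `TwoDimCoefficients`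
(stmt-8062), ✓ `hasDim2Repr_two_mul_sq_le_all : ∃ n₀, ∀ n ≥ n₀, ∀ m, HasDim2Repr n m → 2n² ≤ (m+2)²`
(unconditional: Hessian point of stmt-8061 + unit dichotomy + Gerstenhaber on the unipotent branch), already
EXCLUDES every `(m, ≤ 2)`-representation of `per_n` with `(m + 2)² < 2n²`, in particular both points
`(n, 2)` and `(n + 1, 2)` of the `c = 1` box.  Earlier hand censuses of 8064 listed the `s = 2` points as open,
and `GrenetZeonPolySizeQPAlgebraHomogeneousCorner.lean` (this hand) gave an independent, Gerstenhaber-free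
proof for `(n, 2)` via homogenization; this file records the stronger consequence in the piece's currency:

* `not_hasAlgDetRepr_perPoly_two_of_sq_lt` — `∃ n₀, ∀ n ≥ n₀, ∀ m, (m+2)² < 2n² → ¬ HasAlgDetRepr per_n m 2`.
* `not_hasAlgDetRepr_perPoly_succ_two` — the point `(n + 1, 2)` is empty for large `n`.
* `polySizeQPAlgebra_one_slice_two` — **the `s ≤ 2` slice of the `c = 1` box is empty**:
  `∃ n₀, ∀ n ≥ n₀, ∀ m s, m ≤ n^1 + 1 → s ≤ 2 → ¬ HasAlgDetRepr per_n m s`.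

So the open part of the `c = 1` box is exactly `m ∈ {n, n+1}`, `3 ≤ s ≤ 2·2^(log₂ n)`, non-diagonal witnesses
(diagonal ones: `GrenetZeonPolySizeQPAlgebraLongDiagonal.lean`).  Honest framing: bookkeeping; the registered
stubs of 8064 (`c ≥ 2`) are untouched; nothing here bears on VP ≠ VNP.  Axioms `propext`, `Classical.choice`,
`Quot.sound`.
-/

set_option linter.dupNamespace false

noncomputable section

namespace Summit.ValiantsHypothesis.ValiantsHypothesis.Theorems.GrenetZeonPolySizeQPAlgebra

open MvPolynomial Matrix
open Literature.Computability.AlgebraicComplexity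
open Summit.ValiantsHypothesis.ValiantsHypothesis.Cruxes.TwoDimCoefficients.DimTwoCases

/-- **Below `√2·n` there is no `(m, 2)`-representation of the permanent** (for large `n`): the `√2` rung of
stmt-8062 in `HasAlgDetRepr` currency (`HasDim2Repr n m` is `HasAlgDetRepr (perPoly (Fin n) ℂ) m 2`
verbatim). [folklore] -/
theorem not_hasAlgDetRepr_perPoly_two_of_sq_lt :
    ∃ n₀ : ℕ, ∀ n ≥ n₀, ∀ m : ℕ, (m + 2) ^ 2 < 2 * n ^ 2 → ¬ HasAlgDetRepr (perPoly (Fin n) ℂ) m 2 := by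
  obtain ⟨n₀, h⟩ := hasDim2Repr_two_mul_sq_le_all
  exact ⟨n₀, fun n hn m hlt hrep => absurd (h n hn m hrep) (not_le.mpr hlt)⟩

/-- **The point `(n + 1, 2)` of the `c = 1` box is empty** for large `n` (`(n+3)² < 2n²` once `n ≥ 8`).
[folklore] -/
theorem not_hasAlgDetRepr_perPoly_succ_two :
    ∃ n₀ : ℕ, ∀ n ≥ n₀, ¬ HasAlgDetRepr (perPoly (Fin n) ℂ) (n + 1) 2 := by
  obtain ⟨n₀, h⟩ := not_hasAlgDetRepr_perPoly_two_of_sq_lt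
  refine ⟨max n₀ 8, fun n hn hrep => h n ((le_max_left _ _).trans hn) (n + 1) ?_ hrep⟩
  have h8 : 8 ≤ n := (le_max_right _ _).trans hn
  nlinarith

/-- **The `s ≤ 2` slice of the `c = 1` box of `PolySizeQPAlgebra` is empty:** for large `n`, `per_n` has no
`(m, s)`-representation with `m ≤ n^1 + 1` and `s ≤ 2` (pad to `(n + 1, 2)` by `HasAlgDetRepr.mono`).
[folklore] -/
theorem polySizeQPAlgebra_one_slice_two :
    ∃ n₀ : ℕ, ∀ n ≥ n₀, ∀ m s : ℕ, m ≤ n ^ 1 + 1 → s ≤ 2 →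
      ¬ HasAlgDetRepr (perPoly (Fin n) ℂ) m s := by
  obtain ⟨n₀, h⟩ := not_hasAlgDetRepr_perPoly_succ_two
  refine ⟨n₀, fun n hn m s hm hs hrep => h n hn (hrep.mono ?_ hs)⟩
  simpa only [pow_one] using hm

/-- The same in the verbatim `∃ R …` form of the piece, at the corner `(n + 1, 2)`. [folklore] -/
theorem polySizeQPAlgebra_one_corner_two :
    ∃ n₀ : ℕ, ∀ n ≥ n₀, ¬ (∃ (R : Type) (_ : CommRing R) (_ : Algebra ℂ R) (_ : Module.Finite ℂ R),
      Module.finrank ℂ R ≤ 2 ∧ ∃ (l : R →ₗ[ℂ] ℂ)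
        (A : Matrix (Fin (n + 1)) (Fin (n + 1)) (MvPolynomial (Fin n × Fin n) R)),
        (∀ i j, (A i j).totalDegree ≤ 1) ∧ ∀ d : (Fin n × Fin n) →₀ ℕ,
          l (MvPolynomial.coeff d A.det) = MvPolynomial.coeff d (perPoly (Fin n) ℂ)) :=
  not_hasAlgDetRepr_perPoly_succ_two

end Summit.ValiantsHypothesis.ValiantsHypothesis.Theorems.GrenetZeonPolySizeQPAlgebra

end
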